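import Literature.Geometry.Symplectic.SteinJConvexOpen
import HarnessLib

/-!
# The Levi form at a critical point is the `J`-symmetrised Hessian

Topic `Literature/Geometry/Symplectic`; proofs file of the fact seat of
`Literature.Geometry.Symplectic.Gompf1998_thm13_twoHandles` (**E2**, `SteinTwoHandles.lean`).
Explicit verifications of `J`-convexity (the squared distance to a totally real surface, the
model functions of the standard handle: Cieliebak–Eliashberg 2012, §2.7 and Ch. 8) are made
at critical points, where the Levi form does not see the derivatives of `J`.  In the tree's
formalism (`SteinDomain.lean`: `d^ℂφ = dφ ∘ J`, Levi form `-dd^ℂφ_x(v, J_x v)`, `J` a field of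
endomorphisms of the chartwise-trivialised tangent spaces preserving smooth vector fields)
this file proves, with `c` the chart at `x`, `φ̂ = φ ∘ c⁻¹` and `D`, `D²` derivatives within
the model half-space at `c x`:

* `mfderiv_tangentCoordChange_apply` — `dφ_y(τ_{x→y} u) = Dφ̂(c y)(u)` on the chart domain;
* `JTriv_self_apply` — `Ĵ_x = J_x` in its own trivialization;
* `inChart_dComplex_apply_range` — **`d^ℂφ` read in the chart**: `(d^ℂφ)^(c y)(w) = Dφ̂(c y)(Ĵ_y w)`
  with `Ĵ_y = JTriv J x y` the matrix of `J` in the trivialization at `x` (`SteinJBundle.lean`);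
* `mextDeriv_dComplex_apply_of_isCritical` — **at a critical point of `φ`**,
  `dd^ℂφ_x(a, b) = D²φ̂(a, J_x b) - D²φ̂(b, J_x a)`;
* `levi_apply_of_isCritical` — hence **`-dd^ℂφ_x(a, J_x a) = D²φ̂(a, a) + D²φ̂(J_x a, J_x a)`**
  (`J² = -1`): at a critical point the Levi form is the `J`-symmetrised Hessian, whatever the
  first derivatives of `J`.

Everything is **proved**; no definition, no named fact.

## References

* K. Cieliebak, Ya. Eliashberg, *From Stein to Weinstein and Back*, AMS Colloquium Publ. 59
  (2012), §2.1–§2.2 (the Levi form `-dd^ℂφ`; in complex coordinates it is the complex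
  Hessian), §2.7. [CieliebakEliashberg2012]
-/

noncomputable section

open scoped Manifold ContDiff Topology Bundle
open Set Function Filter Bundle

namespace Literature.Geometry.Symplectic

open Literature.Geometry.Kaehler Literature.Analysis.ODE Literature.NumberTheory.Transcendental

variable {W : Type*} [TopologicalSpace W] [ChartedSpace (EuclideanHalfSpace 4) W]
  [IsManifold (𝓡∂ 4) ∞ W]

/-! ### First derivatives read in the chart at `x` -/

/-- **`dφ_y ∘ τ_{x→y} = Dφ̂(c y)`**: for `y` in the chart domain of `x` and `φ̂ = φ ∘ c⁻¹`
(`c` the extended chart at `x`), `dφ_y(tangentCoordChange x y y u) = Dφ̂(c y)(u)`, the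
derivative taken within the model half-space (chain rule through the chart at `y`).
[folklore] -/
theorem mfderiv_tangentCoordChange_apply {φ : W → ℝ} (hφ : MDifferentiable (𝓡∂ 4) 𝓘(ℝ, ℝ) φ)
    {x y : W} (hy : y ∈ (chartAt (EuclideanHalfSpace 4) x).source) (u : EuclideanSpace ℝ (Fin 4)) :
    rd φ y (tangentCoordChange (𝓡∂ 4) x y y u) =
      fderivWithin ℝ (φ ∘ (extChartAt (𝓡∂ 4) x).symm) (range (𝓡∂ 4)) (extChartAt (𝓡∂ 4) x y) u := by
  set c := extChartAt (𝓡∂ 4) x with hc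
  set c' := extChartAt (𝓡∂ 4) y with hc'
  have hy' : y ∈ c.source := by rw [hc, extChartAt_source]; exact hy
  have hyy : y ∈ c'.source := mem_extChartAt_source y
  have hU : UniqueDiffWithinAt ℝ (range (𝓡∂ 4)) (c y) :=
    (𝓡∂ 4).uniqueDiffOn _ (mem_range_self _)
  -- the transition map and `φ` in the chart at `y`
  have h1 : HasFDerivWithinAt (c' ∘ c.symm) (tangentCoordChange (𝓡∂ 4) x y y) (range (𝓡∂ 4)) (c y) :=
    hasFDerivWithinAt_tangentCoordChange ⟨hy', hyy⟩
  have h2d : DifferentiableWithinAt ℝ (φ ∘ c'.symm) (range (𝓡∂ 4)) (c' y) :=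
    differentiableWithinAt_comp_extChartAt_symm (hφ y)
  have h2e : fderivWithin ℝ (φ ∘ c'.symm) (range (𝓡∂ 4)) (c' y) = rd φ y := by
    have h := (hφ y).mfderiv
    simp only [writtenInExtChartAt, extChartAt_model_space_eq_id, PartialEquiv.refl_coe,
      id_comp] at h
    exact h.symm
  have h2 : HasFDerivWithinAt (φ ∘ c'.symm) (rd φ y) (range (𝓡∂ 4)) ((c' ∘ c.symm) (c y)) := by
    rw [comp_apply, c.left_inv hy', ← h2e]
    exact h2d.hasFDerivWithinAt
  have h3 := h2.comp (c y) h1 fun z _ => mem_range_self _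
  -- `φ ∘ c⁻¹` agrees with the composite near `c y` within the half-space
  have heq : (φ ∘ c.symm) =ᶠ[𝓝[range (𝓡∂ 4)] (c y)] ((φ ∘ c'.symm) ∘ (c' ∘ c.symm)) := by
    have hn : c.symm ⁻¹' c'.source ∈ 𝓝 (c y) :=
      extChartAt_preimage_mem_nhds' hy' ((isOpen_extChartAt_source y).mem_nhds hyy)
    filter_upwards [mem_nhdsWithin_of_mem_nhds hn] with z hz
    simp only [comp_apply]
    rw [c'.left_inv hz]
  have heq0 : (φ ∘ c.symm) (c y) = ((φ ∘ c'.symm) ∘ (c' ∘ c.symm)) (c y) := by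
    simp only [comp_apply]
    rw [c'.left_inv (by rw [c.left_inv hy']; exact hyy)]
  rw [heq.fderivWithin_eq heq0, h3.fderivWithin hU]
  rfl

/-- **At the base point, `Dφ̂(c x) = dφ_x`.** [folklore] -/
theorem fderivWithin_comp_symm_self_apply {φ : W → ℝ} (hφ : MDifferentiable (𝓡∂ 4) 𝓘(ℝ, ℝ) φ)
    (x : W) (u : EuclideanSpace ℝ (Fin 4)) :
    fderivWithin ℝ (φ ∘ (extChartAt (𝓡∂ 4) x).symm) (range (𝓡∂ 4)) (extChartAt (𝓡∂ 4) x x) u =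
      rd φ x u := by
  rw [← mfderiv_tangentCoordChange_apply hφ (mem_chart_source _ x),
    tangentCoordChange_self (mem_extChartAt_source x)]

/-- **`Ĵ_x = J_x` in its own trivialization.** [folklore] -/
theorem JTriv_self_apply (J : (x : W) → (EuclideanSpace ℝ (Fin 4) →L[ℝ] EuclideanSpace ℝ (Fin 4)))
    (x : W) (u : EuclideanSpace ℝ (Fin 4)) : JTriv J x x u = J x u := by
  have h := tangentCoordChange_JTriv J (mem_chart_source _ x) u
  rwa [tangentCoordChange_self (mem_extChartAt_source x),
    tangentCoordChange_self (mem_extChartAt_source x)] at h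

/-- **`d^ℂφ` read in the chart at `x`**: for `y` in the chart domain,
`(d^ℂφ)^(c y)(w) = Dφ̂(c y)(Ĵ_y w)` with `Ĵ_y = JTriv J x y`. [folklore] -/
theorem inChart_dComplex_apply_range (J : (x : W) → (EuclideanSpace ℝ (Fin 4) →L[ℝ] EuclideanSpace ℝ (Fin 4)))
    {φ : W → ℝ} (hφ : MDifferentiable (𝓡∂ 4) 𝓘(ℝ, ℝ) φ) {x y : W}
    (hy : y ∈ (chartAt (EuclideanHalfSpace 4) x).source) (w : EuclideanSpace ℝ (Fin 4)) :
    (dComplex J φ).inChart x (extChartAt (𝓡∂ 4) x y) ![w] =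
      fderivWithin ℝ (φ ∘ (extChartAt (𝓡∂ 4) x).symm) (range (𝓡∂ 4)) (extChartAt (𝓡∂ 4) x y)
        (JTriv J x y w) := by
  rw [inChart_apply_extChartAt _ hy, ← mfderiv_tangentCoordChange_apply hφ hy,
    tangentCoordChange_JTriv J hy]
  rfl

/-! ### Second derivatives at a critical point -/

section Critical

variable [T2Space W] {J : (x : W) → (EuclideanSpace ℝ (Fin 4) →L[ℝ] EuclideanSpace ℝ (Fin 4))}

omit [IsManifold (𝓡∂ 4) ∞ W] [T2Space W] in
/-- `φ̂ = φ ∘ c⁻¹` is `C^∞` within the half-space at `c x`. [folklore] -/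
theorem contDiffWithinAt_comp_symm {φ : W → ℝ} (hφ : ContMDiff (𝓡∂ 4) 𝓘(ℝ, ℝ) ∞ φ) (x : W) :
    ContDiffWithinAt ℝ ∞ (φ ∘ (extChartAt (𝓡∂ 4) x).symm) (range (𝓡∂ 4)) (extChartAt (𝓡∂ 4) x x) := by
  have h := (contMDiffAt_iff.1 (hφ x)).2
  simpa only [writtenInExtChartAt, extChartAt_model_space_eq_id, PartialEquiv.refl_coe,
    id_comp] using h

omit [T2Space W] in
/-- `y ↦ Ĵ_y w` read in the chart at `x` is `C^∞` within the half-space at `c x`. [folklore] -/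
theorem contDiffWithinAt_JTriv_comp_symm [T2Space W] (hJ : PreservesSmoothFields J) (x : W)
    (w : EuclideanSpace ℝ (Fin 4)) :
    ContDiffWithinAt ℝ ∞ (fun q => JTriv J x ((extChartAt (𝓡∂ 4) x).symm q) w) (range (𝓡∂ 4))
      (extChartAt (𝓡∂ 4) x x) := by
  have h := (contMDiffAt_iff.1 (contMDiffAt_JTriv hJ x w (mem_chart_source _ x))).2
  simp only [extChartAt_model_space_eq_id, PartialEquiv.refl_coe, id_comp] at h
  exact h

/-- **The directional derivative of `q ↦ (d^ℂφ)^(q)(b)` at `c x`, at a critical point `x`**: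
`D_a[(d^ℂφ)^(·)(b)](c x) = D²φ̂(c x)(a)(J_x b)` (the term `Dφ̂(c x)((D_a Ĵ) b)` vanishes with
`Dφ̂(c x) = dφ_x = 0`). [folklore] -/
theorem fderivWithin_inChart_dComplex_apply_of_isCritical (hJ : PreservesSmoothFields J)
    {φ : W → ℝ} (hφ : ContMDiff (𝓡∂ 4) 𝓘(ℝ, ℝ) ∞ φ) {x : W}
    (hcrit : mfderiv (𝓡∂ 4) 𝓘(ℝ, ℝ) φ x = 0) (a b : EuclideanSpace ℝ (Fin 4)) :
    fderivWithin ℝ (fun q => (dComplex J φ).inChart x q ![b]) (range (𝓡∂ 4))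
        (extChartAt (𝓡∂ 4) x x) a =
      fderivWithin ℝ (fderivWithin ℝ (φ ∘ (extChartAt (𝓡∂ 4) x).symm) (range (𝓡∂ 4)))
        (range (𝓡∂ 4)) (extChartAt (𝓡∂ 4) x x) a (J x b) := by
  set c := extChartAt (𝓡∂ 4) x with hc
  set s : Set (EuclideanSpace ℝ (Fin 4)) := range (𝓡∂ 4) with hs
  have hφd : MDifferentiable (𝓡∂ 4) 𝓘(ℝ, ℝ) φ := hφ.mdifferentiable (by simp)
  have hU : UniqueDiffOn ℝ s := (𝓡∂ 4).uniqueDiffOn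
  have hq₀ : c x ∈ s := mem_range_self _
  -- the two factors `q ↦ Dφ̂(q)` and `q ↦ Ĵ_{c⁻¹ q} b`
  set P : EuclideanSpace ℝ (Fin 4) → EuclideanSpace ℝ (Fin 4) →L[ℝ] ℝ :=
    fderivWithin ℝ (φ ∘ c.symm) s with hP
  set g : EuclideanSpace ℝ (Fin 4) → EuclideanSpace ℝ (Fin 4) :=
    fun q => JTriv J x (c.symm q) b with hg
  have hPd : DifferentiableWithinAt ℝ P s (c x) :=
    ((contDiffWithinAt_comp_symm hφ x).fderivWithin_right (m := ∞) hU (by simp) hq₀).differentiableWithinAt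
      (by simp)
  have hgd : DifferentiableWithinAt ℝ g s (c x) :=
    (contDiffWithinAt_JTriv_comp_symm hJ x b).differentiableWithinAt (by simp)
  -- the representative agrees with `q ↦ P q (g q)` near `c x` within `s`
  have heq : (fun q => (dComplex J φ).inChart x q ![b]) =ᶠ[𝓝[s] (c x)] fun q => P q (g q) := by
    filter_upwards [extChartAt_target_mem_nhdsWithin x] with q hq
    have hy : c.symm q ∈ (chartAt (EuclideanHalfSpace 4) x).source := by
      rw [← extChartAt_source (I := 𝓡∂ 4)]; exact c.map_target hq
    have h := inChart_dComplex_apply_range J hφd hy b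
    rw [c.right_inv hq] at h
    exact h
  have heq0 : (dComplex J φ).inChart x (c x) ![b] = P (c x) (g (c x)) := by
    have h := inChart_dComplex_apply_range J hφd (mem_chart_source _ x) b
    simp only [hP, hg, c.left_inv (mem_extChartAt_source x)]
    exact h
  rw [heq.fderivWithin_eq heq0, fderivWithin_clm_apply (hU _ hq₀) hPd hgd]
  -- `P (c x) = Dφ̂(c x) = dφ_x = 0`
  have hP0 : P (c x) = 0 := by
    ext u
    rw [hP, fderivWithin_comp_symm_self_apply hφd x u]
    show (mfderiv (𝓡∂ 4) 𝓘(ℝ, ℝ) φ x) u = 0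
    rw [hcrit]
    rfl
  have hg0 : g (c x) = J x b := by
    simp only [hg, c.left_inv (mem_extChartAt_source x)]
    exact JTriv_self_apply J x b
  show P (c x) (fderivWithin ℝ g s (c x) a) + fderivWithin ℝ P s (c x) a (g (c x)) = _
  rw [hP0, hg0]
  simp

/-- **`dd^ℂφ` at a critical point**: `dd^ℂφ_x(a, b) = D²φ̂(a)(J_x b) - D²φ̂(b)(J_x a)`, with
`D²φ̂` the second derivative of `φ ∘ c⁻¹` within the model half-space at `c x`.
[cite: CieliebakEliashberg2012, §2.2] -/
theorem mextDeriv_dComplex_apply_of_isCritical (hJ : PreservesSmoothFields J)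
    {φ : W → ℝ} (hφ : ContMDiff (𝓡∂ 4) 𝓘(ℝ, ℝ) ∞ φ) {x : W}
    (hcrit : mfderiv (𝓡∂ 4) 𝓘(ℝ, ℝ) φ x = 0) (a b : EuclideanSpace ℝ (Fin 4)) :
    mextDeriv (dComplex J φ) x ![a, b] =
      fderivWithin ℝ (fderivWithin ℝ (φ ∘ (extChartAt (𝓡∂ 4) x).symm) (range (𝓡∂ 4)))
          (range (𝓡∂ 4)) (extChartAt (𝓡∂ 4) x x) a (J x b) -
        fderivWithin ℝ (fderivWithin ℝ (φ ∘ (extChartAt (𝓡∂ 4) x).symm) (range (𝓡∂ 4)))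
          (range (𝓡∂ 4)) (extChartAt (𝓡∂ 4) x x) b (J x a) := by
  have hU : UniqueDiffWithinAt ℝ (range (𝓡∂ 4)) (extChartAt (𝓡∂ 4) x x) :=
    (𝓡∂ 4).uniqueDiffOn _ (mem_range_self _)
  have hα : MForm.SmoothAt (dComplex J φ) x := isSmoothForm_dComplex_of_preservesSmoothFields hJ hφ x
  have hd : DifferentiableWithinAt ℝ ((dComplex J φ).inChart x) (range (𝓡∂ 4))
      (extChartAt (𝓡∂ 4) x x) := hα.differentiableWithinAt (by simp)
  have h := congrArg (fun Ω : EuclideanSpace ℝ (Fin 4) [⋀^Fin 2]→L[ℝ] ℝ => Ω ![a, b])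
    (mextDeriv_eq_extDerivWithin_of_chartedSpace (dComplex J φ) x)
  calc mextDeriv (dComplex J φ) x ![a, b]
      = extDerivWithin ((dComplex J φ).inChart x) (range (𝓡∂ 4)) (extChartAt (𝓡∂ 4) x x) ![a, b] := h
    _ = _ := ?_
  rw [extDerivWithin_apply_pair hd hU,
    ← fderivWithin_continuousAlternatingMap_apply_const_apply hU hd ![b] a,
    ← fderivWithin_continuousAlternatingMap_apply_const_apply hU hd ![a] b,
    fderivWithin_inChart_dComplex_apply_of_isCritical hJ hφ hcrit a b,
    fderivWithin_inChart_dComplex_apply_of_isCritical hJ hφ hcrit b a]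

/-- **The Levi form at a critical point is the `J`-symmetrised Hessian**:
`-dd^ℂφ_x(a, J_x a) = D²φ̂(a)(a) + D²φ̂(J_x a)(J_x a)` when `dφ_x = 0` and `J_x² = -1`.
[cite: CieliebakEliashberg2012, §2.2] -/
theorem levi_apply_of_isCritical (hJ : PreservesSmoothFields J) (hJ2 : ∀ x v, J x (J x v) = -v)
    {φ : W → ℝ} (hφ : ContMDiff (𝓡∂ 4) 𝓘(ℝ, ℝ) ∞ φ) {x : W}
    (hcrit : mfderiv (𝓡∂ 4) 𝓘(ℝ, ℝ) φ x = 0) (a : EuclideanSpace ℝ (Fin 4)) :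
    -(mextDeriv (dComplex J φ) x ![a, J x a]) =
      fderivWithin ℝ (fderivWithin ℝ (φ ∘ (extChartAt (𝓡∂ 4) x).symm) (range (𝓡∂ 4)))
          (range (𝓡∂ 4)) (extChartAt (𝓡∂ 4) x x) a a +
        fderivWithin ℝ (fderivWithin ℝ (φ ∘ (extChartAt (𝓡∂ 4) x).symm) (range (𝓡∂ 4)))
          (range (𝓡∂ 4)) (extChartAt (𝓡∂ 4) x x) (J x a) (J x a) := by
  rw [mextDeriv_dComplex_apply_of_isCritical hJ hφ hcrit a (J x a), hJ2, map_neg]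
  ring

end Critical

end Literature.Geometry.Symplectic

end
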